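import Literature.Computability.Cryptography.IIDStatisticalDistance
import Literature.Computability.Cryptography.LWEProofs
import Mathlib.Data.Int.CardIntervalMod
import Mathlib.Data.ZMod.Basic
import HarnessLib

/-!
# Residues of uniform coin blocks are nearly uniform: `Δ(U(2ᴸ) mod q, U(ℤ_q)) ≤ q/2ᴸ`

Topic `Computability/Cryptography` (family `pqc`). The random shift `t ← U(ℤ_qⁿ)` of Regev's Lemma 4.1
(average-case to worst-case secret; the first component of the blocks of `Regev2009.blockLaw` /
`Peikert2009.directBlock`) is drawn by a coin-driven machine as `n` residues `uᵢ mod q` of independent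
uniform `M`-valued coin blocks (`M = 2ᴸ`). Everything here is PROVED; one definition with body
(`modLaw M q`, the law of `u mod q`); no named fact.

* `modLaw M q : PMF (ZMod q)` and `modLaw_apply` — `Pr[u mod q = r] = #{u < M : u ≡ r}/M`, the count being
  `M/q + [r < M mod q]` (Mathlib `Nat.count_modEq_card`);
* **`tvDist_modLaw_uniform_le`** — `Δ(modLaw M q, U(ℤ_q)) ≤ q/M` (each fibre is off by at most one coin
  value: `|#fibre/M - 1/q| ≤ 1/M`);
* (a private copy of `MP12.iidPMF_uniformOfFintype`, `U(β)^{⊗n} = U(βⁿ)`) and **`tvDist_iidPMF_modLaw_le`** — for the vector of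
  `n` residues, `Δ ≤ n·q/M` (`tvDist_iidPMF_le`).

## References

* O. Regev, *On lattices, learning with errors, random linear codes, and cryptography*, J. ACM 56 (2009),
  art. 34, Lemma 4.1 (proof: "`t ∈ ℤ_pⁿ` chosen uniformly at random") [RegevLWE2009].
* O. Goldreich, *Foundations of Cryptography I*, CUP 2001, §3.2.3 (statistical distance of independent
  samples) [Goldreich2001].
-/

noncomputable section

open Finset
open scoped ENNReal

namespace Literature.Computability.Cryptography

namespace LWE

/-- LOCAL GLUE. **The law of `u mod q` for a uniform coin block `u < M`.** [cite: RegevLWE2009, Lemma 4.1 (proof)] -/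
def modLaw (M q : ℕ) [NeZero M] [NeZero q] : PMF (ZMod q) :=
  (PMF.uniformOfFintype (Fin M)).map fun u : Fin M => ((u.val : ℕ) : ZMod q)

/-- **The fibres**: `Pr[u mod q = r] = (M/q + [val r < M mod q])/M`. [folklore] -/
theorem modLaw_apply (M q : ℕ) [NeZero M] [NeZero q] (r : ZMod q) :
    modLaw M q r = ((M / q + if r.val < M % q then 1 else 0 : ℕ) : ℝ≥0∞) / M := by
  classical
  have hq : 0 < q := Nat.pos_of_ne_zero (NeZero.ne q)
  rw [modLaw, PMF.map_apply, tsum_fintype]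
  simp_rw [PMF.uniformOfFintype_apply, Fintype.card_fin]
  have hcount := Nat.count_modEq_card M hq r.val
  rw [Nat.mod_eq_of_lt (ZMod.val_lt r)] at hcount
  rw [← hcount, Nat.count_eq_card_filter_range, ENNReal.div_eq_inv_mul]
  have hind : ∀ u : Fin M, (if r = ((u : ℕ) : ZMod q) then ((M : ℝ≥0∞))⁻¹ else 0) =
      (M : ℝ≥0∞)⁻¹ * (if (u : ℕ) ≡ r.val [MOD q] then 1 else 0) := by
    intro u
    have hiff : r = ((u : ℕ) : ZMod q) ↔ (u : ℕ) ≡ r.val [MOD q] := by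
      rw [Nat.ModEq, Nat.mod_eq_of_lt (ZMod.val_lt r)]
      constructor
      · intro h; rw [h, ZMod.val_natCast]
      · intro h
        rw [← ZMod.natCast_zmod_val r, ZMod.natCast_eq_natCast_iff', Nat.mod_eq_of_lt (ZMod.val_lt r), h]
    by_cases h : r = ((u : ℕ) : ZMod q)
    · rw [if_pos h, if_pos (hiff.1 h), mul_one]
    · rw [if_neg h, if_neg (fun h' => h (hiff.2 h')), mul_zero]
  simp_rw [hind]
  rw [← Finset.mul_sum]
  congr 1
  rw [Finset.sum_boole]
  congr 1
  -- the filter over `Fin M` and over `range M` have the same cardinality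
  have h := Finset.card_map (s := univ.filter fun u : Fin M => (u : ℕ) ≡ r.val [MOD q]) Fin.valEmbedding
  rw [← h]
  congr 1
  ext x
  simp only [Finset.mem_map, Finset.mem_filter, Finset.mem_univ, true_and, Fin.valEmbedding_apply,
    Finset.mem_range]
  constructor
  · rintro ⟨u, hu, rfl⟩; exact ⟨u.isLt, hu⟩
  · rintro ⟨hx, hmod⟩; exact ⟨⟨x, hx⟩, hmod, rfl⟩

/-- **`Δ(u mod q, U(ℤ_q)) ≤ q/M`** for a uniform coin block `u < M`: every fibre count is `M/q` or
`M/q + 1`, so each of the `q` residues is off from `1/q` by at most `1/M`. [cite: RegevLWE2009, Lemma 4.1 (proof); Goldreich2001, §3.2.3] -/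
theorem tvDist_modLaw_uniform_le (M q : ℕ) [NeZero M] [NeZero q] :
    (modLaw M q).tvDist (PMF.uniformOfFintype (ZMod q)) ≤ (q : ℝ) / M := by
  classical
  have hM : (0 : ℝ) < M := Nat.cast_pos.2 (Nat.pos_of_ne_zero (NeZero.ne M))
  have hq : (0 : ℝ) < q := Nat.cast_pos.2 (Nat.pos_of_ne_zero (NeZero.ne q))
  have hqn : 0 < q := Nat.pos_of_ne_zero (NeZero.ne q)
  -- pointwise: `|Pr[r] - 1/q| ≤ 1/M`
  have hpt : ∀ r : ZMod q, |(modLaw M q r).toReal - (PMF.uniformOfFintype (ZMod q) r).toReal| ≤ 1 / M := by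
    intro r
    rw [modLaw_apply, PMF.uniformOfFintype_apply, ZMod.card, ENNReal.toReal_div, ENNReal.toReal_natCast,
      ENNReal.toReal_natCast, ENNReal.toReal_inv, ENNReal.toReal_natCast]
    -- `N = M/q + e`, `e ∈ {0,1}`, and `M = q (M/q) + M % q`
    have hdiv : (M : ℝ) = q * (M / q : ℕ) + (M % q : ℕ) := by exact_mod_cast (Nat.div_add_mod M q).symm
    have hmod : ((M % q : ℕ) : ℝ) < q := by exact_mod_cast Nat.mod_lt M hqn
    have hmod0 : (0 : ℝ) ≤ (M % q : ℕ) := Nat.cast_nonneg _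
    rw [abs_le]
    constructor
    · -- lower: `N/M ≥ (M/q)/M ≥ 1/q - 1/M`
      have hN : ((M / q : ℕ) : ℝ) ≤ ((M / q + if r.val < M % q then 1 else 0 : ℕ) : ℝ) := by
        exact_mod_cast Nat.le_add_right _ _
      have h1 : ((M / q : ℕ) : ℝ) / M ≤ ((M / q + if r.val < M % q then 1 else 0 : ℕ) : ℝ) / M :=
        div_le_div_of_nonneg_right hN hM.le
      have h2 : (q : ℝ)⁻¹ - 1 / M ≤ ((M / q : ℕ) : ℝ) / M := by
        rw [inv_eq_one_div, div_sub_div _ _ hq.ne' hM.ne', div_le_div_iff₀ (mul_pos hq hM) hM]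
        nlinarith
      linarith
    · -- upper: `N/M ≤ (M/q + 1)/M ≤ 1/q + 1/M`
      have hN : ((M / q + if r.val < M % q then 1 else 0 : ℕ) : ℝ) ≤ ((M / q : ℕ) : ℝ) + 1 := by
        split_ifs <;> push_cast <;> linarith
      have h1 : ((M / q + if r.val < M % q then 1 else 0 : ℕ) : ℝ) / M ≤ (((M / q : ℕ) : ℝ) + 1) / M :=
        div_le_div_of_nonneg_right hN hM.le
      have h2 : (((M / q : ℕ) : ℝ) + 1) / M ≤ (q : ℝ)⁻¹ + 1 / M := by
        rw [inv_eq_one_div, div_add_div _ _ hq.ne' hM.ne', div_le_div_iff₀ hM (mul_pos hq hM)]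
        nlinarith
      linarith
  rw [PMF.tvDist, tsum_fintype]
  calc 2⁻¹ * ∑ r : ZMod q, |(modLaw M q r).toReal - (PMF.uniformOfFintype (ZMod q) r).toReal|
      ≤ 2⁻¹ * ∑ _r : ZMod q, (1 : ℝ) / M := mul_le_mul_of_nonneg_left (Finset.sum_le_sum fun r _ => hpt r) (by norm_num)
    _ = 2⁻¹ * (q / M) := by rw [Finset.sum_const, Finset.card_univ, ZMod.card, nsmul_eq_mul]; ring
    _ ≤ q / M := by
        have h0 : 0 ≤ (q : ℝ) / M := by positivity
        linarith

/-- The iid product of a uniform law is the uniform law on tuples. PRIVATE COPY of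
`Literature.Computability.Cryptography.LWE.MP12.iidPMF_uniformOfFintype` (`LWEPrimePowerRounding.lean`, the
public survivor): importing that file (the modulus-switching machinery of BLPRS/MP12) into this small law file
would be the wrong dependency direction. [folklore] -/
private theorem iidPMF_uniformOfFintype' (β : Type) [Fintype β] [Nonempty β] (m : ℕ) :
    iidPMF (PMF.uniformOfFintype β) m = PMF.uniformOfFintype (Fin m → β) := by
  ext v
  rw [PMF.uniformOfFintype_apply, iidPMF_apply_holds]
  simp only [PMF.uniformOfFintype_apply, Finset.prod_const, Finset.card_univ, Fintype.card_fin,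
    Fintype.card_fun, Nat.cast_pow, ENNReal.inv_pow]

/-- **The vector of `n` residues is `n·q/M`-close to `U(ℤ_qⁿ)`** (Regev's shift `t` drawn from coins).
[cite: RegevLWE2009, Lemma 4.1 (proof); Goldreich2001, §3.2.3] -/
theorem tvDist_iidPMF_modLaw_le (M q : ℕ) [NeZero M] [NeZero q] (n : ℕ) :
    (iidPMF (modLaw M q) n).tvDist (PMF.uniformOfFintype (Fin n → ZMod q)) ≤ n * ((q : ℝ) / M) := by
  rw [← iidPMF_uniformOfFintype']
  exact (tvDist_iidPMF_le _ _ n).trans (mul_le_mul_of_nonneg_left (tvDist_modLaw_uniform_le M q) (Nat.cast_nonneg n))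

end LWE

end Literature.Computability.Cryptography

end
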